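import Mathlib.Analysis.Calculus.Deriv.Shift
import Literature.MathematicalPhysics.KineticTheory.CellChain

/-!
# Site-dependent oscillator chains: Fourier's law predicates, the generator under a change of
potentials, and the dilute conjunct chain

Topic `Literature/MathematicalPhysics/KineticTheory`, grouping namespace `…KineticTheory.HeatConduction`
of `FouriersLaw.lean` (`OscillatorChain`, `pinnedChain`, `OscillatorChain.FouriersLawFor`) and
`CellChain.lean` (`SiteChain`). Definition request `defn-SiteDependentOscillatorChain`, filed by route
`AtomisticToContinuum/FouriersLaw/Theses/GaussianiserCellTransfer` (items DiluteFourierLaw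
stmt-AtomisticToContinuum-4265, SpacingClosure 4266, PerCellResistanceLimit 4267, DiluteNessExists
4268, SpacingOneDictionary 4269 inline the objects below as explicit sums; the route was retired on
2026-08-15 under D-0027 §2.1 with its file kept as the record, and a successor route from the same
idea card, like the sibling dilute/impurity routes DilutePhononLorentzGas and MatthiessenIncrements,
states its items over the objects defined here).

## The requested notion already exists

The requested structure — chains of unit-mass oscillators between Langevin heat baths with
SITE-DEPENDENT pinning `U : ℕ → ℝ → ℝ` and bond potentials `V : ℕ → ℝ → ℝ`, bath coupling `γ`, with
`hamiltonian / generator / bondCurrent / totalCurrent / IsSteadyState` copied verbatim from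
`OscillatorChain` and the `rfl`-embedding `OscillatorChain.toSiteChain` — IS `SiteChain` of
`CellChain.lean` (request `defn-CellChain`). It is not re-declared: `SiteDependentOscillatorChain` below
is a reducible alias (dot-notation `P.generator`, … resolves to `SiteChain.*`). This file adds what
`CellChain.lean` does not have.

## Contents (all proved; no named fact)

* `SiteChain.FouriersLawAt P T` — clause (ii) of Bonetto–Lebowitz–Rey-Bellet's law (33) AT ONE
  TEMPERATURE `T`: `∃ k > 0` such that for every family of weak steady states the finite-size
  response limits `D_N = lim_{δ→0, δ≠0} totalCurrent(μ_{N,T+δ/2,T-δ/2})/δ` exist and `D_N → k`;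
  `SiteChain.FouriersLawFor P` — VERBATIM `OscillatorChain.FouriersLawFor` ((i) existence and
  uniqueness of steady states for all `N, T_L, T_R > 0`; (ii) a conductivity `κ(T) ∈ (0, ∞)` for all
  `T > 0`); `fouriersLawFor_iff` : (ii) is `∀ T > 0, FouriersLawAt T` (choice of `κ`);
  `OscillatorChain.toSiteChain_fouriersLawFor_iff` (`Iff.rfl`).
* CALCULUS of the verbatim generator for differentiable potentials: `SiteChain.partialQ_hamiltonian`
  (`∂_{q_i} H = U_i'(q_i) + Σ_bonds (δ_{j i} - δ_{k i}) V_k'(q_j - q_k)`), the FORCE FORM of the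
  generator `SiteChain.generator_eq`
  (`L f = Σ_i (p_i ∂_{q_i} f - U_i'(q_i) ∂_{p_i} f + Σ_{j=i+1} V_i'(q_j - q_i)(∂_{p_i} f - ∂_{p_j} f)) + baths`,
  BLR eq. (10)), and the PERTURBATION LEMMA `SiteChain.generator_eq_generator_add`: two chains with the
  same bath coupling differ by the first-order drift of the difference of their forces.
* `diluteChain ω₂ lam β γ d` — the `d`-DILUTE CONJUNCT CHAIN: the pinned harmonic host
  `pinnedChain ω₂ 0 0 γ` carrying the anharmonic unit of the conjunct's `pinnedChain ω₂ lam β γ`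
  (on-site `lam q⁴/4` AND the FPU-β term `β r⁴/4` on the following bond) exactly at the sites `i` with
  `d ∣ i`; `diluteChain_one : diluteChain ω₂ lam β γ 1 = (pinnedChain ω₂ lam β γ).toSiteChain`,
  `diluteChain_lam_zero_β_zero` (no anharmonicity: the host), `diluteChain_eq_cellChain` (it is the
  `cellChain` of `CellChain.lean` with indicator `decide (d ∣ i)`), and the DICTIONARY with the inline
  objects of the route, all proved: `diluteChain_generator` (host generator + explicit cell drifts),
  `diluteChain_bondCurrent`, `diluteChain_totalCurrent`, `diluteChain_isSteadyState_iff`,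
  `diluteChain_fouriersLawAt_iff`, and at `d = 1` `diluteChain_one_isSteadyState_iff`,
  `diluteChain_one_totalCurrent` (the two conjuncts of SpacingOneDictionary).

## Sources

Bonetto–Lebowitz–Rey-Bellet 2000, §3 eq. (8) (crystal Hamiltonian with site-dependent pinning `U_i`:
"for many purpose it is enough to put the potential `U_i` on only some of the atoms"), §4.1 eq. (10)
(Langevin reservoirs, `ṗ_i = -∇_{q_i}H …`), §5.2 eq. (23) (bond current), §1 and §5.3 eq. (31)–(33)
(`κ(T) = lim_{L→∞} L lim_{δT→0} J̃/δT`, "the existence of such a limit with `κ` positive and finite is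
what one would like to prove"). Cuneo–Eckmann–Hairer–Rey-Bellet 2018, §2 eq. (2.1)–(2.2) (networks
with vertex potentials `U_v`, edge potentials `V_e`). Dhar 2008, §5 first display (the pinned
anharmonic chain `∑_l [p_l²/2m_l + k_o x_l²/2 + λ x_l⁴/4] + ∑_l [k (x_l - x_{l-1})²/2 + ν (x_l - x_{l-1})⁴/4]`
between white-noise baths, there with random masses and constant `λ, ν`; the dilute chain has this
form with unit masses and the quartic couplings made site-dependent, `λ_i = [d ∣ i] lam`,
`ν_i = [d ∣ i] β`, which BLR's (8) / CEHR's (2.1) allow).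

## Design choices

* `FouriersLawAt` carries NO existence/uniqueness clause (it is clause (ii) only, as the route's
  rung DiluteFourierLaw wants it; vacuous for a chain without steady states at some size — the route
  de-vacuifies it by a separate existence item), while `FouriersLawFor` keeps clause (i) inside the
  claim exactly as `OscillatorChain.FouriersLawFor` does.
* The dictionary lemmas are stated with right-hand sides in the literal shape of the route's inline
  sums (`if d ∣ i.val then -(lam * x.1 i ^ 3 * partialP i f x) else 0`, …), so that the items restate
  over `diluteChain` by `simp only [diluteChain_fouriersLawAt_iff]` / `Iff.rfl`.
* `d ∣ i` puts a cell at site `0` for every `d` (and ONLY there for `d = 0`: the one-cell chain);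
  `CellChain.cellPeriodic ℓ` uses `ℓ ∣ i + 1` instead — `diluteChain_eq_cellChain` is the bridge.
* Potentials of `diluteChain` are the payload's `ω₂ q²/2 + (if d ∣ i then lam q⁴/4 else 0)` (the `if`
  outside the monomial); equality with the `cellChain` shape `(if … then lam else 0) q⁴/4` is a
  propositional `SiteChain.ext`, not `rfl`.
* NOT here: dynamics/semigroups, existence or uniqueness of steady states of site-dependent chains
  (Cuneo–Eckmann–Hairer–Rey-Bellet 2018 Thm 2.13 is vendored for `pinnedChain` elsewhere), infinite
  volume. Searched (`lean search`): `SiteDependent`, `diluteChain`, `FouriersLawAt`, `SiteChain` —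
  only `CellChain.lean` / `InhomogeneousChainEnvironment.lean`, which this file extends.
-/

noncomputable section

open MeasureTheory Filter Topology
open scoped ContDiff

namespace Literature.MathematicalPhysics.KineticTheory.HeatConduction

/-- **Site-dependent oscillator chain** — the name under which route GaussianiserCellTransfer requests
the notion: a chain of unit-mass oscillators between Langevin heat baths (coupling `γ` at sites `0` and
`N - 1`) with site-dependent pinning `U i` and bond potentials `V i` (bond `(i, i+1)`), i.e. the
Cuneo–Eckmann–Hairer–Rey-Bellet network on a path with baths at both ends, Bonetto–Lebowitz–Rey-Bellet's
crystal (8) in `d = 1`. This is LITERALLY `SiteChain` (`CellChain.lean`): a reducible alias, so that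
all `SiteChain.*` API (Hamiltonian, generator, currents, steady states, `FouriersLawAt/For` below)
applies by dot-notation. [Bonetto–Lebowitz–Rey-Bellet 2000, §3 eq. (8), §4.1 eq. (10)]
[cite: CuneoEckmannHairerReyBellet2018, §2 eq. (2.1)-(2.2)] -/
abbrev SiteDependentOscillatorChain : Type := SiteChain

namespace SiteChain

variable (P : SiteChain)

/-! ### Fourier's law for site-dependent chains -/

/-- **Fourier's law at temperature `T`** for the site-dependent chain `P` — clause (ii) of
Bonetto–Lebowitz–Rey-Bellet's eq. (33) at ONE temperature: there is a conductivity value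
`k = κ(T)` with `0 < k < ∞` such that for EVERY family `μ N T_L T_R` of weak steady states
(`P.IsSteadyState`, all `N` and `T_L, T_R > 0`) the finite-size linear-response limits
`D_N = lim_{δ→0, δ≠0} (∑_bonds μ_{N,T+δ/2,T-δ/2}(j_i))/δ` exist for every `N` and `D_N → k` as `N → ∞`
(`κ = lim_{L→∞} L lim_{δT→0} J̃/δT` with `T = (T_L+T_R)/2`, `δT = T_L - T_R`). A predicate (the
problem BLR pose, for `P` at `T`), vacuous in `μ` if `P` has no steady state at some size; no
existence/uniqueness clause (cf. `FouriersLawFor`). [Bonetto–Lebowitz–Rey-Bellet 2000, §1 and §5.3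
eq. (31)–(33)] [cite: BonettoLebowitzReyBellet2000, §5.3 eq. (33)] -/
def FouriersLawAt (T : ℝ) : Prop :=
  ∃ k : ℝ, 0 < k ∧
    ∀ μ : (N : ℕ) → ℝ → ℝ → Measure (PhaseSpace N),
      (∀ (N : ℕ) (T_L T_R : ℝ), 0 < T_L → 0 < T_R → P.IsSteadyState N T_L T_R (μ N T_L T_R)) →
        ∃ D : ℕ → ℝ,
          (∀ N : ℕ, Tendsto (fun δ : ℝ => P.totalCurrent (μ N (T + δ / 2) (T - δ / 2)) / δ)
            (𝓝[≠] 0) (𝓝 (D N))) ∧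
          Tendsto D atTop (𝓝 k)

/-- **Fourier's law for the site-dependent chain `P`** — VERBATIM `OscillatorChain.FouriersLawFor`:
(i) for all `N` and `T_L, T_R > 0` a weak steady state exists AND is unique (BLR §5.1 item 1, part of
the claim, not a hypothesis), and (ii) there is `κ : ℝ → ℝ` with `0 < κ(T) < ∞` for `T > 0` such that
for every family of steady states and every `T > 0` the response limits `D_N` exist and
`D_N → κ(T)` (BLR eq. (33)). [Bonetto–Lebowitz–Rey-Bellet 2000, §1, §5.1, §5.3 eq. (33)]
[cite: BonettoLebowitzReyBellet2000, §5.3 eq. (33)] -/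
def FouriersLawFor (P : SiteChain) : Prop :=
  (∀ (N : ℕ) (T_L T_R : ℝ), 0 < T_L → 0 < T_R →
      ∃ μ : Measure (PhaseSpace N), P.IsSteadyState N T_L T_R μ ∧
        ∀ ν : Measure (PhaseSpace N), P.IsSteadyState N T_L T_R ν → ν = μ) ∧
  ∃ κ : ℝ → ℝ, (∀ T, 0 < T → 0 < κ T) ∧
    ∀ μ : (N : ℕ) → ℝ → ℝ → Measure (PhaseSpace N),
      (∀ (N : ℕ) (T_L T_R : ℝ), 0 < T_L → 0 < T_R → P.IsSteadyState N T_L T_R (μ N T_L T_R)) →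
      ∀ T : ℝ, 0 < T →
        ∃ D : ℕ → ℝ,
          (∀ N : ℕ, Tendsto (fun δ : ℝ => P.totalCurrent (μ N (T + δ / 2) (T - δ / 2)) / δ)
            (𝓝[≠] 0) (𝓝 (D N))) ∧
          Tendsto D atTop (𝓝 (κ T))

/-- `FouriersLawFor` = (existence and uniqueness of steady states) ∧ (Fourier's law at every `T > 0`):
clause (ii) with a conductivity FUNCTION `κ` is equivalent to the pointwise law at each `T > 0`
(`→`: `k = κ T`; `←`: choose `κ T` for `T > 0`). [folklore] -/
theorem fouriersLawFor_iff :
    P.FouriersLawFor ↔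
      (∀ (N : ℕ) (T_L T_R : ℝ), 0 < T_L → 0 < T_R →
          ∃ μ : Measure (PhaseSpace N), P.IsSteadyState N T_L T_R μ ∧
            ∀ ν : Measure (PhaseSpace N), P.IsSteadyState N T_L T_R ν → ν = μ) ∧
        ∀ T : ℝ, 0 < T → P.FouriersLawAt T := by
  refine and_congr_right fun _ => ⟨?_, ?_⟩
  · rintro ⟨κ, hκ, h⟩ T hT
    exact ⟨κ T, hκ T hT, fun μ hμ => h μ hμ T hT⟩
  · intro h
    choose! k hk using h
    exact ⟨k, fun T hT => (hk T hT).1, fun μ hμ T hT => (hk T hT).2 μ hμ⟩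

/-- Clause (ii) of `FouriersLawFor` gives the pointwise law at every `T > 0`. [folklore] -/
theorem FouriersLawFor.fouriersLawAt {P : SiteChain} (h : P.FouriersLawFor) {T : ℝ} (hT : 0 < T) :
    P.FouriersLawAt T :=
  ((fouriersLawFor_iff P).1 h).2 T hT

/-! ### `∂H/∂q` and the generator for differentiable potentials -/

/-- **`∂_{q_i} H`** for differentiable site/bond potentials:
`∂_{q_i} H = U_i'(q_i) + ∑_k ∑_{j = k+1} (δ_{j i} - δ_{k i}) V_k'(q_j - q_k)`, i.e.
`U_i'(q_i) + V_{i-1}'(q_i - q_{i-1})·[0 < i] - V_i'(q_{i+1} - q_i)·[i+1 < N]` — minus the force of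
Bonetto–Lebowitz–Rey-Bellet's equations of motion (10), for `SiteChain.hamiltonian` (differentiating
through `Function.update`). [cite: BonettoLebowitzReyBellet2000, §3 eq. (8) and §4.1 eq. (10)] -/
theorem partialQ_hamiltonian {N : ℕ} (hU : ∀ i, Differentiable ℝ (P.U i))
    (hV : ∀ i, Differentiable ℝ (P.V i)) (i : Fin N) (x : PhaseSpace N) :
    partialQ i (P.hamiltonian N) x =
      deriv (P.U i.val) (x.1 i) +
        ∑ k : Fin N, ∑ j : Fin N, if j.val = k.val + 1 then
          ((if j = i then (1 : ℝ) else 0) - (if k = i then 1 else 0)) *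
            deriv (P.V k.val) (x.1 j - x.1 k) else 0 := by
  unfold partialQ SiteChain.hamiltonian
  have h1 : HasDerivAt
      (fun t : ℝ => ∑ k : Fin N, ((x.2 k) ^ 2 / 2 + P.U k.val (Function.update x.1 i t k)))
      (∑ k : Fin N, if k = i then deriv (P.U i.val) (x.1 i) else 0) (x.1 i) := by
    apply HasDerivAt.fun_sum
    intro k _
    by_cases hk : k = i
    · subst hk
      simp only [Function.update_self, if_true]
      exact ((hU k.val (x.1 k)).hasDerivAt).const_add _
    · simp only [Function.update_of_ne hk, hk, if_false]
      exact hasDerivAt_const _ _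
  have h2 : HasDerivAt (fun t : ℝ => ∑ k : Fin N, ∑ j : Fin N,
        (if j.val = k.val + 1 then
          P.V k.val (Function.update x.1 i t j - Function.update x.1 i t k) else 0))
      (∑ k : Fin N, ∑ j : Fin N, if j.val = k.val + 1 then
          ((if j = i then (1 : ℝ) else 0) - (if k = i then 1 else 0)) *
            deriv (P.V k.val) (x.1 j - x.1 k) else 0) (x.1 i) := by
    apply HasDerivAt.fun_sum
    intro k _
    apply HasDerivAt.fun_sum
    intro j _
    by_cases hjk : j.val = k.val + 1
    · simp only [if_pos hjk]
      by_cases hji : j = i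
      · have hki : k ≠ i := by
          rintro rfl; rw [hji] at hjk; omega
        subst hji
        simp only [Function.update_self, Function.update_of_ne hki, if_true, hki, if_false, sub_zero,
          one_mul]
        exact ((hV k.val _).hasDerivAt).comp_sub_const (x.1 j) (x.1 k)
      · by_cases hki : k = i
        · subst hki
          simp only [Function.update_self, Function.update_of_ne hji, hji, if_false, if_true,
            zero_sub, neg_one_mul]
          exact ((hV k.val _).hasDerivAt).comp_const_sub (x.1 j) (x.1 k)
        · simp only [Function.update_of_ne hji, Function.update_of_ne hki, hji, hki, if_false,
            sub_zero, zero_mul]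
          exact hasDerivAt_const _ _
    · simp only [if_neg hjk]
      exact hasDerivAt_const _ _
  have h1' : (∑ k : Fin N, if k = i then deriv (P.U i.val) (x.1 i) else 0) =
      deriv (P.U i.val) (x.1 i) := by
    simp
  rw [← h1']
  exact (h1.add h2).deriv

/-- Resummation over bonds: pairing the bond coefficients `(δ_{j i} - δ_{k i}) w_{k j}` against `g_i`
gives `∑_{bonds} w_{k j} (g_j - g_k)`. [folklore] -/
theorem sum_bondCoeff_mul {N : ℕ} (w : Fin N → Fin N → ℝ) (g : Fin N → ℝ) :
    ∑ i : Fin N, (∑ k : Fin N, ∑ j : Fin N, if j.val = k.val + 1 then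
        ((if j = i then (1 : ℝ) else 0) - (if k = i then 1 else 0)) * w k j else 0) * g i =
      ∑ k : Fin N, ∑ j : Fin N, if j.val = k.val + 1 then w k j * (g j - g k) else 0 := by
  simp only [Finset.sum_mul]
  rw [Finset.sum_comm]
  refine Finset.sum_congr rfl fun k _ => ?_
  rw [Finset.sum_comm]
  refine Finset.sum_congr rfl fun j _ => ?_
  by_cases hjk : j.val = k.val + 1
  · simp only [if_pos hjk]
    have h : ∀ i : Fin N,
        ((if j = i then (1 : ℝ) else 0) - (if k = i then 1 else 0)) * w k j * g i =
          (if j = i then w k j * g i else 0) - (if k = i then w k j * g i else 0) := by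
      intro i; split_ifs <;> ring
    simp only [h, Finset.sum_sub_distrib, Finset.sum_ite_eq, Finset.mem_univ, if_true]
    ring
  · simp only [if_neg hjk, zero_mul, Finset.sum_const_zero]

/-- **Force form of the generator.** For differentiable potentials the verbatim generator is the
explicit first-order-plus-bath operator
`L f = ∑_i (p_i ∂_{q_i} f - U_i'(q_i) ∂_{p_i} f + ∑_{j = i+1} V_i'(q_j - q_i) (∂_{p_i} f - ∂_{p_j} f)) + γ ∑_{baths} (T ∂²_{p} f - p ∂_{p} f)`
— Bonetto–Lebowitz–Rey-Bellet's (10): the bond `(i, i+1)` pushes `p_i` with `+V_i'` and `p_{i+1}`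
with `-V_i'`. No hypothesis on `f`. [cite: BonettoLebowitzReyBellet2000, §4.1 eq. (10)] -/
theorem generator_eq {N : ℕ} (hU : ∀ i, Differentiable ℝ (P.U i))
    (hV : ∀ i, Differentiable ℝ (P.V i)) (T_L T_R : ℝ) (f : PhaseSpace N → ℝ) (x : PhaseSpace N) :
    P.generator N T_L T_R f x =
      (∑ i : Fin N, (x.2 i * partialQ i f x - deriv (P.U i.val) (x.1 i) * partialP i f x +
        ∑ j : Fin N, if j.val = i.val + 1 then
          deriv (P.V i.val) (x.1 j - x.1 i) * (partialP i f x - partialP j f x) else 0)) +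
      P.γ * ∑ i : Fin N,
        ((if i.val = 0 then T_L * partialP i (partialP i f) x - x.2 i * partialP i f x else 0) +
          (if i.val = N - 1 then T_R * partialP i (partialP i f) x - x.2 i * partialP i f x
            else 0)) := by
  unfold generator
  congr 1
  simp only [P.partialQ_hamiltonian hU hV]
  have key := sum_bondCoeff_mul (fun k j => deriv (P.V k.val) (x.1 j - x.1 k))
    (fun i => partialP i f x)
  have e1 : (∑ i : Fin N, (x.2 i * partialQ i f x -
      (deriv (P.U i.val) (x.1 i) +
        ∑ k : Fin N, ∑ j : Fin N, if j.val = k.val + 1 then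
          ((if j = i then (1 : ℝ) else 0) - (if k = i then 1 else 0)) *
            deriv (P.V k.val) (x.1 j - x.1 k) else 0) * partialP i f x)) =
      (∑ i : Fin N, (x.2 i * partialQ i f x - deriv (P.U i.val) (x.1 i) * partialP i f x)) -
        ∑ i : Fin N, (∑ k : Fin N, ∑ j : Fin N, if j.val = k.val + 1 then
          ((if j = i then (1 : ℝ) else 0) - (if k = i then 1 else 0)) *
            deriv (P.V k.val) (x.1 j - x.1 k) else 0) * partialP i f x := by
    rw [← Finset.sum_sub_distrib]
    exact Finset.sum_congr rfl fun i _ => by ring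
  have e2 : (∑ k : Fin N, ∑ j : Fin N, if j.val = k.val + 1 then
        deriv (P.V k.val) (x.1 j - x.1 k) * (partialP j f x - partialP k f x) else 0) =
      -∑ i : Fin N, ∑ j : Fin N, if j.val = i.val + 1 then
        deriv (P.V i.val) (x.1 j - x.1 i) * (partialP i f x - partialP j f x) else 0 := by
    rw [← Finset.sum_neg_distrib]
    refine Finset.sum_congr rfl fun i _ => ?_
    rw [← Finset.sum_neg_distrib]
    refine Finset.sum_congr rfl fun j _ => ?_
    split_ifs <;> ring
  rw [e1, key, e2, sub_neg_eq_add, ← Finset.sum_add_distrib]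

/-- **Perturbation lemma.** Two site-dependent chains with the same bath coupling and differentiable
potentials have generators differing by the drift of the force difference:
`L_P f = L_Q f + ∑_i (-(U_{P,i}' - U_{Q,i}')(q_i) ∂_{p_i} f + ∑_{j=i+1} (V_{P,i}' - V_{Q,i}')(q_j - q_i)(∂_{p_i} f - ∂_{p_j} f))`
(adding a potential `W` to `H` adds the Hamiltonian vector field `-∇_q W · ∇_p`). [folklore] -/
theorem generator_eq_generator_add {P Q : SiteChain} (hγ : P.γ = Q.γ)
    (hPU : ∀ i, Differentiable ℝ (P.U i)) (hPV : ∀ i, Differentiable ℝ (P.V i))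
    (hQU : ∀ i, Differentiable ℝ (Q.U i)) (hQV : ∀ i, Differentiable ℝ (Q.V i))
    (N : ℕ) (T_L T_R : ℝ) (f : PhaseSpace N → ℝ) (x : PhaseSpace N) :
    P.generator N T_L T_R f x = Q.generator N T_L T_R f x +
      ∑ i : Fin N, (-((deriv (P.U i.val) (x.1 i) - deriv (Q.U i.val) (x.1 i)) * partialP i f x) +
        ∑ j : Fin N, if j.val = i.val + 1 then
          (deriv (P.V i.val) (x.1 j - x.1 i) - deriv (Q.V i.val) (x.1 j - x.1 i)) *
            (partialP i f x - partialP j f x) else 0) := by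
  rw [P.generator_eq hPU hPV, Q.generator_eq hQU hQV, hγ, add_right_comm, ← Finset.sum_add_distrib]
  congr 1
  refine Finset.sum_congr rfl fun i _ => ?_
  have h : (∑ j : Fin N, if j.val = i.val + 1 then
        deriv (P.V i.val) (x.1 j - x.1 i) * (partialP i f x - partialP j f x) else 0) =
      (∑ j : Fin N, if j.val = i.val + 1 then
        deriv (Q.V i.val) (x.1 j - x.1 i) * (partialP i f x - partialP j f x) else 0) +
      ∑ j : Fin N, if j.val = i.val + 1 then
        (deriv (P.V i.val) (x.1 j - x.1 i) - deriv (Q.V i.val) (x.1 j - x.1 i)) *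
          (partialP i f x - partialP j f x) else 0 := by
    rw [← Finset.sum_add_distrib]
    exact Finset.sum_congr rfl fun j _ => by split_ifs <;> ring
  rw [h]
  ring

end SiteChain

namespace OscillatorChain

/-- The embedding of homogeneous chains preserves Fourier's law, definitionally (both predicates are
the same formula over `rfl`-equal steady states and currents). [folklore] -/
theorem toSiteChain_fouriersLawFor_iff (P : OscillatorChain) :
    P.toSiteChain.FouriersLawFor ↔ P.FouriersLawFor :=
  Iff.rfl

end OscillatorChain

/-! ### The dilute conjunct chain -/

/-- The **`d`-dilute conjunct chain** `C_d(ω₂, lam, β, γ)`: the pinned harmonic host (`ω₂ q²/2`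
pinning, unit harmonic bonds, Langevin baths `γ` at both ends — `pinnedChain ω₂ 0 0 γ`) carrying the
anharmonic unit of the conjunct's chain `pinnedChain ω₂ lam β γ` — on-site `lam q_i⁴/4` AND the FPU-β
term `β (q_{i+1} - q_i)⁴/4` on the following bond — exactly at the CELLS, the sites `i` with `d ∣ i`:
`U_i(q) = ω₂ q²/2 + [d ∣ i] lam q⁴/4`, `V_i(r) = r²/2 + [d ∣ i] β r⁴/4`. So `C_1` is the conjunct's
chain (`diluteChain_one`), `C_d` has harmonic segments of `d - 1` sites between consecutive cells,
site `0` is always a cell, and `C_0` has the single cell `0`. The Hamiltonian has the form of Dhar's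
pinned anharmonic chain (§5, first display: `k_o x²/2 + λ x⁴/4` on site, `k r²/2 + ν r⁴/4` on bonds)
with unit masses and the quartic couplings made site-dependent, `λ_i = [d ∣ i] lam`,
`ν_i = [d ∣ i] β`; an instance of BLR's class (8) ("the potential `U_i` on only some of the atoms")
and of the CEHR network (2.1) on a path. [Dhar 2008, §5 (first display); Bonetto–Lebowitz–Rey-Bellet
2000, §3 eq. (8), §10 item 1] [cite: BonettoLebowitzReyBellet2000, §3 eq. (8) and §10 item 1] -/
def diluteChain (ω₂ lam β γ : ℝ) (d : ℕ) : SiteChain where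
  U i q := ω₂ * q ^ 2 / 2 + if d ∣ i then lam * q ^ 4 / 4 else 0
  V i r := r ^ 2 / 2 + if d ∣ i then β * r ^ 4 / 4 else 0
  γ := γ

section DiluteChain

variable (ω₂ lam β γ : ℝ) (d : ℕ)

/-- The bath coupling of the dilute chain. [folklore] -/
@[simp] theorem diluteChain_γ : (diluteChain ω₂ lam β γ d).γ = γ := rfl

/-- The pinning of the dilute chain at site `i`. [folklore] -/
theorem diluteChain_U (i : ℕ) (q : ℝ) :
    (diluteChain ω₂ lam β γ d).U i q = ω₂ * q ^ 2 / 2 + if d ∣ i then lam * q ^ 4 / 4 else 0 :=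
  rfl

/-- The potential of the bond `(i, i+1)` of the dilute chain. [folklore] -/
theorem diluteChain_V (i : ℕ) (r : ℝ) :
    (diluteChain ω₂ lam β γ d).V i r = r ^ 2 / 2 + if d ∣ i then β * r ^ 4 / 4 else 0 :=
  rfl

/-- **Spacing one is the conjunct's chain**: `C_1 = pinnedChain ω₂ lam β γ` as site chains (`1 ∣ i`
always). [folklore] -/
theorem diluteChain_one : diluteChain ω₂ lam β γ 1 = (pinnedChain ω₂ lam β γ).toSiteChain := by
  refine SiteChain.ext ?_ ?_ rfl
  · funext i q
    simp [diluteChain, pinnedChain]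
  · funext i r
    simp [diluteChain, pinnedChain]

/-- Without anharmonicity the dilute chain is the harmonic host `pinnedChain ω₂ 0 0 γ`, whatever the
spacing. [folklore] -/
theorem diluteChain_lam_zero_β_zero :
    diluteChain ω₂ 0 0 γ d = (pinnedChain ω₂ 0 0 γ).toSiteChain := by
  refine SiteChain.ext ?_ ?_ rfl
  · funext i q
    simp [diluteChain, pinnedChain]
  · funext i r
    simp [diluteChain, pinnedChain]

/-- The dilute chain is the cell chain of `CellChain.lean` with cell indicator `i ↦ decide (d ∣ i)`
(same potentials; only the placement of the `if` differs). [folklore] -/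
theorem diluteChain_eq_cellChain :
    diluteChain ω₂ lam β γ d = cellChain ω₂ lam β γ (fun i => decide (d ∣ i)) := by
  refine SiteChain.ext ?_ ?_ rfl
  · funext i q
    by_cases h : d ∣ i <;> simp [diluteChain, cellChain, h]
  · funext i r
    by_cases h : d ∣ i <;> simp [diluteChain, cellChain, h]

/-- Derivative of `a q²/2 + b q⁴/4`. [folklore] -/
theorem hasDerivAt_quadratic_add_quartic (a b q : ℝ) :
    HasDerivAt (fun q : ℝ => a * q ^ 2 / 2 + b * q ^ 4 / 4) (a * q + b * q ^ 3) q := by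
  have h : HasDerivAt (fun q : ℝ => a * q ^ 2 / 2 + b * q ^ 4 / 4)
      (a * (((2 : ℕ) : ℝ) * q ^ (2 - 1)) / 2 + b * (((4 : ℕ) : ℝ) * q ^ (4 - 1)) / 4) q :=
    (((hasDerivAt_pow 2 q).const_mul a).div_const 2).add
      (((hasDerivAt_pow 4 q).const_mul b).div_const 4)
  refine h.congr_deriv ?_
  simp only [Nat.cast_ofNat, show (2 - 1 : ℕ) = 1 from rfl, show (4 - 1 : ℕ) = 3 from rfl, pow_one]
  ring

/-- The pinning of the dilute chain with the cell indicator as a coefficient (the `cellChain` shape).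
[folklore] -/
theorem diluteChain_U_eq (i : ℕ) :
    (diluteChain ω₂ lam β γ d).U i =
      fun q => ω₂ * q ^ 2 / 2 + (if d ∣ i then lam else 0) * q ^ 4 / 4 := by
  funext q
  by_cases h : d ∣ i <;> simp [diluteChain, h]

/-- The bond potential of the dilute chain with the cell indicator as a coefficient. [folklore] -/
theorem diluteChain_V_eq (i : ℕ) :
    (diluteChain ω₂ lam β γ d).V i =
      fun r => 1 * r ^ 2 / 2 + (if d ∣ i then β else 0) * r ^ 4 / 4 := by
  funext r
  by_cases h : d ∣ i <;> simp [diluteChain, h]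

/-- `U_i'(q) = ω₂ q + [d ∣ i] lam q³`. [folklore] -/
theorem deriv_diluteChain_U (i : ℕ) (q : ℝ) :
    deriv ((diluteChain ω₂ lam β γ d).U i) q = ω₂ * q + if d ∣ i then lam * q ^ 3 else 0 := by
  rw [diluteChain_U_eq, (hasDerivAt_quadratic_add_quartic ω₂ (if d ∣ i then lam else 0) q).deriv]
  split_ifs <;> ring

/-- `V_i'(r) = r + [d ∣ i] β r³`. [folklore] -/
theorem deriv_diluteChain_V (i : ℕ) (r : ℝ) :
    deriv ((diluteChain ω₂ lam β γ d).V i) r = r + if d ∣ i then β * r ^ 3 else 0 := by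
  rw [diluteChain_V_eq, (hasDerivAt_quadratic_add_quartic 1 (if d ∣ i then β else 0) r).deriv]
  split_ifs <;> ring

/-- The potentials of the dilute chain are differentiable (pinning). [folklore] -/
theorem differentiable_diluteChain_U (i : ℕ) :
    Differentiable ℝ ((diluteChain ω₂ lam β γ d).U i) := by
  rw [diluteChain_U_eq]
  exact fun q => (hasDerivAt_quadratic_add_quartic ω₂ _ q).differentiableAt

/-- The potentials of the dilute chain are differentiable (bonds). [folklore] -/
theorem differentiable_diluteChain_V (i : ℕ) :
    Differentiable ℝ ((diluteChain ω₂ lam β γ d).V i) := by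
  rw [diluteChain_V_eq]
  exact fun r => (hasDerivAt_quadratic_add_quartic 1 _ r).differentiableAt

/-- **The generator of the dilute chain is the host's generator plus the cell drifts**:
`L_{C_d} f = L_{pinnedChain ω₂ 0 0 γ} f + ∑_i (-[d ∣ i] lam q_i³ ∂_{p_i} f + ∑_{j=i+1} [d ∣ i] β (q_j - q_i)³ (∂_{p_i} f - ∂_{p_j} f))`
— literally the inline generator of route GaussianiserCellTransfer (no hypothesis on `f`).
[cite: BonettoLebowitzReyBellet2000, §4.1 eq. (10)] -/
theorem diluteChain_generator (N : ℕ) (T_L T_R : ℝ) (f : PhaseSpace N → ℝ) (x : PhaseSpace N) :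
    (diluteChain ω₂ lam β γ d).generator N T_L T_R f x =
      (pinnedChain ω₂ 0 0 γ).generator N T_L T_R f x +
        ∑ i : Fin N, ((if d ∣ i.val then -(lam * x.1 i ^ 3 * partialP i f x) else 0) +
          ∑ j : Fin N, (if j.val = i.val + 1 ∧ d ∣ i.val then
            β * (x.1 j - x.1 i) ^ 3 * (partialP i f x - partialP j f x) else 0)) := by
  rw [← OscillatorChain.toSiteChain_generator, ← diluteChain_lam_zero_β_zero ω₂ γ d,
    SiteChain.generator_eq_generator_add (P := diluteChain ω₂ lam β γ d)
      (Q := diluteChain ω₂ 0 0 γ d) rfl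
      (differentiable_diluteChain_U ω₂ lam β γ d) (differentiable_diluteChain_V ω₂ lam β γ d)
      (differentiable_diluteChain_U ω₂ 0 0 γ d) (differentiable_diluteChain_V ω₂ 0 0 γ d)]
  congr 1
  refine Finset.sum_congr rfl fun i _ => ?_
  simp only [deriv_diluteChain_U, deriv_diluteChain_V]
  congr 1
  · split_ifs <;> ring
  · refine Finset.sum_congr rfl fun j _ => ?_
    by_cases hj : j.val = i.val + 1
    · by_cases hd : d ∣ i.val
      · simp only [if_pos hj, if_pos hd,
          if_pos (show j.val = i.val + 1 ∧ d ∣ i.val from ⟨hj, hd⟩)]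
        ring
      · simp only [if_pos hj, if_neg hd,
          if_neg (show ¬(j.val = i.val + 1 ∧ d ∣ i.val) from fun h => hd h.2)]
        ring
    · simp only [if_neg hj, if_neg (show ¬(j.val = i.val + 1 ∧ d ∣ i.val) from fun h => hj h.1)]

/-- **The bond currents of the dilute chain**, literally the inline currents of the route:
`j_i = ∑_{j=i+1} -((p_i + p_j)/2 · ((q_j - q_i) + [d ∣ i] β (q_j - q_i)³))`.
[cite: BonettoLebowitzReyBellet2000, §5.2 eq. (23)] -/
theorem diluteChain_bondCurrent (N : ℕ) (i : Fin N) :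
    (diluteChain ω₂ lam β γ d).bondCurrent N i = fun x =>
      ∑ j : Fin N, (if j.val = i.val + 1 then
        -((x.2 i + x.2 j) / 2 * ((x.1 j - x.1 i) +
          (if d ∣ i.val then β * (x.1 j - x.1 i) ^ 3 else 0))) else 0) := by
  funext x
  simp only [SiteChain.bondCurrent, deriv_diluteChain_V]

/-- The space-summed mean current of the dilute chain in the route's inline form. [folklore] -/
theorem diluteChain_totalCurrent {N : ℕ} (μ : Measure (PhaseSpace N)) :
    (diluteChain ω₂ lam β γ d).totalCurrent μ =
      ∑ i : Fin N, ∫ x, (∑ j : Fin N, (if j.val = i.val + 1 then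
        -((x.2 i + x.2 j) / 2 * ((x.1 j - x.1 i) +
          (if d ∣ i.val then β * (x.1 j - x.1 i) ^ 3 else 0))) else 0)) ∂μ := by
  simp only [SiteChain.totalCurrent, diluteChain_bondCurrent]

/-- **Weak steady states of the dilute chain, unfolded** to the route's inline predicate
(host generator plus cell drifts; inline currents). [folklore] -/
theorem diluteChain_isSteadyState_iff (N : ℕ) (T_L T_R : ℝ) (μ : Measure (PhaseSpace N)) :
    (diluteChain ω₂ lam β γ d).IsSteadyState N T_L T_R μ ↔
      (IsProbabilityMeasure μ ∧
        (∀ f : PhaseSpace N → ℝ, ContDiff ℝ ∞ f → HasCompactSupport f →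
          ∫ x, ((pinnedChain ω₂ 0 0 γ).generator N T_L T_R f x +
            ∑ i : Fin N, ((if d ∣ i.val then -(lam * x.1 i ^ 3 * partialP i f x) else 0) +
              ∑ j : Fin N, (if j.val = i.val + 1 ∧ d ∣ i.val then
                β * (x.1 j - x.1 i) ^ 3 * (partialP i f x - partialP j f x) else 0))) ∂μ = 0) ∧
        ∀ i : Fin N, Integrable (fun x : PhaseSpace N => ∑ j : Fin N, (if j.val = i.val + 1 then
          -((x.2 i + x.2 j) / 2 * ((x.1 j - x.1 i) +
            (if d ∣ i.val then β * (x.1 j - x.1 i) ^ 3 else 0))) else 0)) μ) := by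
  simp only [SiteChain.IsSteadyState, diluteChain_generator, diluteChain_bondCurrent]

/-- **Fourier's law at `T` for the dilute chain, unfolded** to the route's inline form (the body of
DiluteFourierLaw / SpacingClosure / PerCellResistanceLimit after the spacing quantifiers).
[folklore] -/
theorem diluteChain_fouriersLawAt_iff (T : ℝ) :
    (diluteChain ω₂ lam β γ d).FouriersLawAt T ↔
      ∃ k : ℝ, 0 < k ∧
        ∀ μ : (N : ℕ) → ℝ → ℝ → Measure (PhaseSpace N),
          (∀ (N : ℕ) (T_L T_R : ℝ), 0 < T_L → 0 < T_R →
            (IsProbabilityMeasure (μ N T_L T_R) ∧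
              (∀ f : PhaseSpace N → ℝ, ContDiff ℝ ∞ f → HasCompactSupport f →
                ∫ x, ((pinnedChain ω₂ 0 0 γ).generator N T_L T_R f x +
                  ∑ i : Fin N, ((if d ∣ i.val then -(lam * x.1 i ^ 3 * partialP i f x) else 0) +
                    ∑ j : Fin N, (if j.val = i.val + 1 ∧ d ∣ i.val then
                      β * (x.1 j - x.1 i) ^ 3 * (partialP i f x - partialP j f x) else 0)))
                  ∂(μ N T_L T_R) = 0) ∧
              ∀ i : Fin N, Integrable (fun x : PhaseSpace N => ∑ j : Fin N,
                (if j.val = i.val + 1 then -((x.2 i + x.2 j) / 2 * ((x.1 j - x.1 i) +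
                  (if d ∣ i.val then β * (x.1 j - x.1 i) ^ 3 else 0))) else 0)) (μ N T_L T_R))) →
          ∃ D : ℕ → ℝ,
            (∀ N : ℕ, Tendsto (fun δ : ℝ => (∑ i : Fin N, ∫ x, (∑ j : Fin N,
              (if j.val = i.val + 1 then -((x.2 i + x.2 j) / 2 * ((x.1 j - x.1 i) +
                (if d ∣ i.val then β * (x.1 j - x.1 i) ^ 3 else 0))) else 0))
                ∂(μ N (T + δ / 2) (T - δ / 2))) / δ) (𝓝[≠] 0) (𝓝 (D N))) ∧
            Tendsto D atTop (𝓝 k) := by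
  simp only [SiteChain.FouriersLawAt, diluteChain_isSteadyState_iff, diluteChain_totalCurrent]

/-- **Spacing-one dictionary (steady states)**: the inline weak-steady-state predicate of `C_1` IS
`(pinnedChain ω₂ lam β γ).IsSteadyState` (first conjunct of SpacingOneDictionary). [folklore] -/
theorem diluteChain_one_isSteadyState_iff (N : ℕ) (T_L T_R : ℝ) (μ : Measure (PhaseSpace N)) :
    (IsProbabilityMeasure μ ∧
        (∀ f : PhaseSpace N → ℝ, ContDiff ℝ ∞ f → HasCompactSupport f →
          ∫ x, ((pinnedChain ω₂ 0 0 γ).generator N T_L T_R f x +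
            ∑ i : Fin N, ((if 1 ∣ i.val then -(lam * x.1 i ^ 3 * partialP i f x) else 0) +
              ∑ j : Fin N, (if j.val = i.val + 1 ∧ 1 ∣ i.val then
                β * (x.1 j - x.1 i) ^ 3 * (partialP i f x - partialP j f x) else 0))) ∂μ = 0) ∧
        ∀ i : Fin N, Integrable (fun x : PhaseSpace N => ∑ j : Fin N, (if j.val = i.val + 1 then
          -((x.2 i + x.2 j) / 2 * ((x.1 j - x.1 i) +
            (if 1 ∣ i.val then β * (x.1 j - x.1 i) ^ 3 else 0))) else 0)) μ) ↔
      (pinnedChain ω₂ lam β γ).IsSteadyState N T_L T_R μ := by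
  rw [← diluteChain_isSteadyState_iff ω₂ lam β γ 1 N T_L T_R μ, diluteChain_one,
    OscillatorChain.toSiteChain_isSteadyState]

/-- **Spacing-one dictionary (currents)**: the inline total current of `C_1` IS
`(pinnedChain ω₂ lam β γ).totalCurrent` (second conjunct of SpacingOneDictionary). [folklore] -/
theorem diluteChain_one_totalCurrent {N : ℕ} (μ : Measure (PhaseSpace N)) :
    (∑ i : Fin N, ∫ x, (∑ j : Fin N, (if j.val = i.val + 1 then
        -((x.2 i + x.2 j) / 2 * ((x.1 j - x.1 i) +
          (if 1 ∣ i.val then β * (x.1 j - x.1 i) ^ 3 else 0))) else 0)) ∂μ) =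
      (pinnedChain ω₂ lam β γ).totalCurrent μ := by
  rw [← diluteChain_totalCurrent ω₂ lam β γ 1 μ, diluteChain_one, OscillatorChain.toSiteChain_totalCurrent]

/-- **Spacing-one dictionary (Fourier's law)**: the pointwise law for `C_1` IS the pointwise law for
the conjunct's chain. [folklore] -/
theorem diluteChain_one_fouriersLawAt_iff (T : ℝ) :
    (diluteChain ω₂ lam β γ 1).FouriersLawAt T ↔
      (pinnedChain ω₂ lam β γ).toSiteChain.FouriersLawAt T := by
  rw [diluteChain_one]

end DiluteChain

end Literature.MathematicalPhysics.KineticTheory.HeatConduction
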